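import Summits.AtomisticToContinuum.HydrodynamicLimit.Theorems.CollisionIsometryCLTMacroClosureStubLedgerLogPartition
import Literature.MathematicalPhysics.KineticTheory.LambertianRedrawNondegenerate
import HarnessLib

/-!
# The position partition function over a window of a smooth local Gibbs family
# (crux `LambertianEuler`, stmt-AtomisticToContinuum-11854, line `Sketch`; tool E1 of the kernel's ESTIMATE)

Helper file (`--supports`) of the crux
`Summit.AtomisticToContinuum.HydrodynamicLimit.Theses.LindebergRandomFuture.LambertianEuler`, line `Sketch`.
The FORMULA of the line (`…ExpectedWindowProduction.stub_expectedWindowProductionLambda`) writes the expected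
one-window entropy production of the Lambertian gas as
`(log Zpos(a_{s+h}) − log Zpos(a_s)) − E_λ[streaming] − E_λ[collisions]`.  The first, purely STATIC term is here
turned into a time integral of one-time expectations under the reference family, in the same currency as the
Fubini form of the streaming term (`…StreamingFubini.integral_window_streaming_swap`):

`log Zpos(a_{s+h}) − log Zpos(a_s) = ∫_s^{s+h} (N+1) · E_{ψ_r}⟨emp_z, ∂_r log prof_r⟩ dr`

for profiles `a, θ > 0`, `u` jointly smooth on `[0, T)` and a window `0 ≤ s ≤ s + h < T` with `0 < s + h`
(`log_posPartition_window`).  This is the landed log-partition calculus of smooth local Gibbs families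
(`MacroClosureLine.stub_ledger_logPartition`: derivative within `[0, s+h]`, continuous) integrated by the
fundamental theorem of calculus, with `Z_can = Zpos` for local Gibbs profiles
(`canonicalPartition_eq_posPartition`) and the window-dependent one-sided time derivative replaced, at the
interior times that carry the integral, by the derivative within `[0, T)`.

References: H.-T. Yau, Lett. Math. Phys. 22 (1991) §2 (`∂_t log Z_t = E_{ψ_t}[∂_t log ψ_t]`). All `[folklore]`.
-/

noncomputable section

namespace Summit.AtomisticToContinuum.HydrodynamicLimit.Theorems.LambertianContactSwapLambertianEulerLogPartitionWindow

open scoped BigOperators Topology ENNReal InnerProductSpace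
open MeasureTheory ProbabilityTheory Filter Set InformationTheory
open Literature.MathematicalPhysics.KineticTheory
open Literature.Analysis.FluidPDE Literature.Analysis.FluidPDE.Alexander
open Literature.Analysis.FunctionSpaces

/-- Restriction of joint smoothness in time. [folklore] -/
theorem isSmoothSpaceTimeOn_mono {S S' : Set ℝ} {F : Type*} [NormedAddCommGroup F] [NormedSpace ℝ F]
    {ψ : ℝ → T3 → F} (h : Torus.IsSmoothSpaceTimeOn S ψ) (hS : S' ⊆ S) : Torus.IsSmoothSpaceTimeOn S' ψ :=
  ContDiffOn.mono h (prod_mono hS subset_rfl)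

/-- At interior times the one-sided time derivatives within two neighbourhoods agree. [folklore] -/
theorem derivWithin_eq_of_mem_nhds {f : ℝ → ℝ} {S S' : Set ℝ} {r : ℝ} (hS : S ∈ 𝓝 r) (hS' : S' ∈ 𝓝 r) :
    derivWithin f S r = derivWithin f S' r := by
  rw [derivWithin_of_mem_nhds hS, derivWithin_of_mem_nhds hS']

/-- **The position partition function over a window** (tool E1 of the kernel's ESTIMATE, line `Sketch` of the
crux `LambertianEuler`): for `0 < σ < 1/2`, profiles `a, θ > 0`, `u` jointly smooth on `[0, T)`, every `N`, `Φ`, and a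
window `0 ≤ s ≤ s + h < T` with `0 < s + h`,
`log Zpos(a_{s+h}) − log Zpos(a_s) = ∫_s^{s+h} (N+1) E_{ψ_r}⟨emp_z, ∂_r log prof_r⟩ dr`, the time derivative taken within
`[0, T)`. [cite: Yau1991, §2] -/
theorem log_posPartition_window : ∀ {σ : ℝ}, 0 < σ → σ < 2⁻¹ →
    ∀ (T : ℝ) (N : ℕ) (Φ : HardSphereFlow (Torus.geometry (Fin 3)) (hsDiameter σ N) (N + 1))
      (a θ : ℝ → T3 → ℝ) (u : ℝ → T3 → V3),
      Torus.IsSmoothSpaceTimeOn (Set.Ico 0 T) a → Torus.IsSmoothSpaceTimeOn (Set.Ico 0 T) θ →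
      Torus.IsSmoothSpaceTimeOn (Set.Ico 0 T) u →
      (∀ t ∈ Set.Ico 0 T, ∀ x, 0 < a t x) → (∀ t ∈ Set.Ico 0 T, ∀ x, 0 < θ t x) →
      ∀ (s h : ℝ), 0 ≤ s → 0 ≤ h → s + h < T → 0 < s + h →
        Real.log (posPartition (a (s + h)) (hsDiameter σ N) (N + 1)) -
            Real.log (posPartition (a s) (hsDiameter σ N) (N + 1)) =
          ∫ r in s..(s + h), ((N : ℝ) + 1) *
            ∫ z, (∫ y, derivWithin (fun s' => Real.log (localGibbsProfile (a s') (u s') (θ s') y)) (Set.Ico 0 T) r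
              ∂(empiricalMeasure z)) ∂(localGibbsLaw σ (a r) (u r) (θ r) N Φ) := by
  intro σ hσ hσ' T N Φ a θ u ha hθ hu ha0 hθ0 s h hs hh hshT hpos
  have hsb : s ≤ s + h := le_add_of_nonneg_right hh
  have hsub : Set.Icc 0 (s + h) ⊆ Set.Ico 0 T := fun r hr => ⟨hr.1, hr.2.trans_lt hshT⟩
  -- the landed log-partition calculus on `[0, s+h]`
  obtain ⟨hder, hcont⟩ := MacroClosureLine.stub_ledger_logPartition σ hσ hσ' N Φ (s + h) hpos a θ u
    (isSmoothSpaceTimeOn_mono ha hsub) (isSmoothSpaceTimeOn_mono hθ hsub) (isSmoothSpaceTimeOn_mono hu hsub)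
    (fun r hr => ha0 r (hsub hr)) (fun r hr => hθ0 r (hsub hr))
  set F : ℝ → ℝ := fun s' => Real.log (canonicalPartition (Torus.geometry (Fin 3)) (hsDiameter σ N) (N + 1)
    (localGibbsProfile (a s') (u s') (θ s'))) with hF
  set D₁ : ℝ → ℝ := fun r => ((N : ℝ) + 1) * ∫ z, (∫ y, derivWithin
    (fun s' => Real.log (localGibbsProfile (a s') (u s') (θ s') y)) (Set.Icc 0 (s + h)) r
      ∂(empiricalMeasure z)) ∂(localGibbsLaw σ (a r) (u r) (θ r) N Φ) with hD₁
  -- `Z_can = Zpos` at the two ends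
  have hZ : ∀ {r : ℝ}, r ∈ Set.Ico 0 T → F r = Real.log (posPartition (a r) (hsDiameter σ N) (N + 1)) := by
    intro r hr
    simp only [hF, canonicalPartition_eq_posPartition (ha.isSmooth_slice hr).continuous (hθ.isSmooth_slice hr).continuous
      (hu.isSmooth_slice hr).continuous (fun x => (ha0 r hr x).le) (hθ0 r hr)]
  -- FTC on `[s, s+h]`
  have hFc : ContinuousOn F (Set.Icc s (s + h)) := fun r hr =>
    ((hder r ⟨hs.trans hr.1, hr.2⟩).continuousWithinAt.mono (Set.Icc_subset_Icc hs le_rfl))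
  have hFd : ∀ r ∈ Set.Ioo s (s + h), HasDerivWithinAt F (D₁ r) (Set.Ioi r) r := by
    intro r hr
    have hrI : r ∈ Set.Icc 0 (s + h) := ⟨hs.trans hr.1.le, hr.2.le⟩
    have hnhds : Set.Icc 0 (s + h) ∈ 𝓝 r := Icc_mem_nhds (hs.trans_lt hr.1) hr.2
    exact ((hder r hrI).hasDerivAt hnhds).hasDerivWithinAt
  have hD₁c : ContinuousOn D₁ (Set.Icc s (s + h)) :=
    (continuousOn_const.mul hcont).mono (Set.Icc_subset_Icc hs le_rfl)
  have hFTC : ∫ r in s..(s + h), D₁ r = F (s + h) - F s :=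
    intervalIntegral.integral_eq_sub_of_hasDeriv_right_of_le hsb hFc hFd (hD₁c.intervalIntegrable_of_Icc hsb)
  rw [← hZ ⟨hs.trans hsb, hshT⟩, ← hZ ⟨hs, hsb.trans_lt hshT⟩, ← hFTC]
  -- the two one-sided derivatives agree at the interior times that carry the integral
  refine intervalIntegral.integral_congr_ae ?_
  have hne : ∀ᵐ r ∂(volume : Measure ℝ), r ∉ ({s + h} : Set ℝ) :=
    measure_eq_zero_iff_ae_notMem.1 Real.volume_singleton
  filter_upwards [hne] with r hr hrI
  rw [Set.uIoc_of_le hsb] at hrI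
  have hlt : r < s + h := lt_of_le_of_ne hrI.2 hr
  have h1 : Set.Icc 0 (s + h) ∈ 𝓝 r := Icc_mem_nhds (hs.trans_lt hrI.1) hlt
  have h2 : Set.Ico 0 T ∈ 𝓝 r := Ico_mem_nhds (hs.trans_lt hrI.1) (hlt.trans hshT)
  simp only [hD₁, derivWithin_eq_of_mem_nhds h1 h2]

end Summit.AtomisticToContinuum.HydrodynamicLimit.Theorems.LambertianContactSwapLambertianEulerLogPartitionWindow

end
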